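import Summits.Parity.GeneralizedHardyLittlewood.Theorems.GreenTaoLevelTwoGITwoCyclicInverseBohrSize

/-!
# Route `GreenTaoLevelTwo`, crux `GITwo` (stmt-Parity-21275), line `birth`, stub `stub_cyclicInverse`:
# the local antisymmetric form `{x,y} = M(x)·y − M(y)·x` (bookkeeping for GT08a arXiv Lemma 46)

Fortieth helper file toward the XL stub `stub_cyclicInverse` (B. Green, T. Tao, *An inverse theorem
for the Gowers `U³(G)` norm*, arXiv:math/0503014, Thm. 68 = PEMS 51 (2008) Thm. 12.8).
The symmetry argument (arXiv Lemma 46, block C12) and §9 Step 3 (block C13) manipulate the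
`ℝ/ℤ`-valued form `{x,y} := M(x)·y − M(y)·x` of a locally additive frequency map `M : ℤ/Nℤ → ℤ/Nℤ`
(`ξ·y = toAddCircle(ξy)`), through the displayed identities (bilinear):
`{x+x',y} = {x,y} + {x',y}`, `{x,y+y'} = {x,y} + {x,y'}` and (Step 3)
`2Mh·x = M(x+h)·(x+h) − Mx·x − Mh·h − {x,h}`, each valid where `M` is additive on the pair involved.
This def-free file records them (the form is spelled out inline):

* `antisym_add_left`, `antisym_add_right` — local bilinearity;
* `antisym_neg_swap` — antisymmetry `{y,x} = −{x,y}`;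
* `two_mul_pair_eq` — the Step-3 identity.

References: [GreenTao2008U3Inverse] arXiv:math/0503014, Lemma 46 (display (bilinear)) and §9
Step 3.
-/

noncomputable section

namespace Summit.Parity.GeneralizedHardyLittlewood.GreenTaoLevelTwoGITwoCyclicInverse

variable {N : ℕ} [NeZero N]

/-- Antisymmetry: `{y,x} = −{x,y}`. [folklore] -/
theorem antisym_neg_swap (M : ZMod N → ZMod N) (x y : ZMod N) :
    ZMod.toAddCircle (M y * x) - ZMod.toAddCircle (M x * y) =
      -(ZMod.toAddCircle (M x * y) - ZMod.toAddCircle (M y * x)) := by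
  abel

/-- Local bilinearity in the first variable: if `M(x + x') = M x + M x'` then
`{x+x', y} = {x,y} + {x',y}`. [cite: GreenTao2008U3Inverse, Lemma 46 (display (bilinear))] -/
theorem antisym_add_left (M : ZMod N → ZMod N) {x x' : ZMod N} (hM : M (x + x') = M x + M x')
    (y : ZMod N) :
    ZMod.toAddCircle (M (x + x') * y) - ZMod.toAddCircle (M y * (x + x')) =
      (ZMod.toAddCircle (M x * y) - ZMod.toAddCircle (M y * x)) +
        (ZMod.toAddCircle (M x' * y) - ZMod.toAddCircle (M y * x')) := by
  rw [hM, add_mul, mul_add, map_add, map_add]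
  abel

/-- Local bilinearity in the second variable: if `M(y + y') = M y + M y'` then
`{x, y+y'} = {x,y} + {x,y'}`. [cite: GreenTao2008U3Inverse, Lemma 46 (display (bilinear))] -/
theorem antisym_add_right (M : ZMod N → ZMod N) (x : ZMod N) {y y' : ZMod N}
    (hM : M (y + y') = M y + M y') :
    ZMod.toAddCircle (M x * (y + y')) - ZMod.toAddCircle (M (y + y') * x) =
      (ZMod.toAddCircle (M x * y) - ZMod.toAddCircle (M y * x)) +
        (ZMod.toAddCircle (M x * y') - ZMod.toAddCircle (M y' * x)) := by
  rw [hM, add_mul, mul_add, map_add, map_add]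
  abel

/-- **The §9 Step 3 identity**: if `M(x + h) = M x + M h` then
`2Mh·x = M(x+h)·(x+h) − Mx·x − Mh·h − {x,h}` in `ℝ/ℤ`.
[cite: GreenTao2008U3Inverse, §9 Step 3] -/
theorem two_mul_pair_eq (M : ZMod N → ZMod N) {x h : ZMod N} (hM : M (x + h) = M x + M h) :
    ZMod.toAddCircle (2 * M h * x) =
      ZMod.toAddCircle (M (x + h) * (x + h)) - ZMod.toAddCircle (M x * x) -
        ZMod.toAddCircle (M h * h) - (ZMod.toAddCircle (M x * h) - ZMod.toAddCircle (M h * x)) := by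
  rw [hM]
  have h1 : (M x + M h) * (x + h) = M x * x + M x * h + M h * x + M h * h := by ring
  have h2 : 2 * M h * x = M h * x + M h * x := by ring
  rw [h1, h2, map_add, map_add, map_add, map_add]
  abel

end Summit.Parity.GeneralizedHardyLittlewood.GreenTaoLevelTwoGITwoCyclicInverse
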